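import Summits.ResolutionOfSingularities.ResolutionOfSingularities.Theorems.WildQuotientsSummitReductionStubPairOrbitBlowupCentreNewLemmas
import Summits.ResolutionOfSingularities.ResolutionOfSingularities.Theorems.WildQuotientsSummitReductionStubPairOrbitBlowupCentreNewOrbitLemmas
import Summits.ResolutionOfSingularities.ResolutionOfSingularities.Theorems.WildQuotientsSummitReductionStubPairOrbitBlowupClaimOfCentre
import Literature.AlgebraicGeometry.Resolution.AlterationsSemiStableCodimTwoCentreFormal
import Literature.AlgebraicGeometry.Resolution.SncStrata
import Mathlib.RingTheory.Flat.FaithfullyFlat.Algebra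
import HarnessLib

/-!
# `WildQuotients.SummitReduction` (stmt-ResolutionOfSingularities-16324), line `FramePerfect`, skeleton v8:
# helper lemmas for stub `stub_pair_orbitBlowupCentreNew` (C3) — the formal model at a point of the
# orbit closure `cl(G · x)`, and its completed ideal `(u, v, T_{i₀})` (de Jong 1996, 3.4 ¶2; de Jong
# 1997, proof of 5.11 ¶1)

Route `ResolutionOfSingularities/WildQuotients`, crux `SummitReduction`; worker file supporting the
registered stub `stub_pair_orbitBlowupCentreNew` of the line skeleton (v8, lead c4).

For the curve `f : X ⟶ Y` of a quasi-split `G`-semi-stable pair of the line with `G`-STRICT boundary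
`D`, a codimension-`≤ 2` singular point `x` and a point `z` of the orbit closure `Z = cl(G · x)`,
i.e. `g₀ x ⤳ z` for some `g₀` (`centreNew_mem_closure_orbit_iff`), `centreNew_exists_orbitModel`
assembles:

* the base-compatible formal model `e₁ : 𝒪̂_{X,z} ≅ Â⟦u, v⟧/(uv - ∏ ŵᵢ^{νᵢ})` on a regular system of
  parameters `w` of `A = 𝒪_{Y,f z}` adapted to `D`, with Cohen coordinates `ι` and the rebracketing
  `E` to `K⟦u, v, T⟧/(uv - ∏ Tᵢ^{νᵢ})` (`centreNew_exists_baseModel`, `centreNew_formalNodeRing_of_baseModel`;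
  de Jong 1996, 2.23 + 3.3 at the quasi-split point `z`);
* 3.4 ¶2 at `z` for the prime `𝔭_{g₀ x}` of the translate: it completes to `(u, v, T_{i₀})` with
  `ν_{i₀} ≥ 2`, `i₀` being the only index with `f^#(w_{i₀}) ∈ 𝔭_{g₀ x}`
  (`codimTwo_map_adicCompletion_eq_triplePrime`; `𝒪_{X,z}` is a G-ring, Matsumura §32);
* **the translates of `x` through `z` coincide** (de Jong 1997, 5.11 ¶1: "`T' = ∪ g(T)` is a
  disjoint union"): two of them lie over the same point of `Y` by `G`-strictness
  (`centreNew_apply_eq_of_specializes`), hence have the same index `i₀`, the same completed prime,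
  the same prime (faithful flatness of `𝒪_{X,z} → 𝒪̂_{X,z}`), and are equal (Stacks 01J7);
* hence **the stalk at `z` of the reduced ideal of `Z` is the prime `𝔭_{g₀ x}`** (it is radical with
  zero set the generizations of `z` in `Z`, `stalkIdeal_vanishingIdeal_eq_vanishingIdeal_setOf`), and
  it completes to `(u, v, T_{i₀})` — the input of the transfer `centreNew_transfer`.
-/

set_option linter.dupNamespace false

noncomputable section

open CategoryTheory CategoryTheory.Limits AlgebraicGeometry TopologicalSpace Topology
open Literature.AlgebraicGeometry.Resolution
open Literature.AlgebraicGeometry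
open IsLocalRing Scheme.IdealSheafData DeJong1996 DeJong1996.FormalNodeRing NodalDeformation

namespace Summit.ResolutionOfSingularities.ResolutionOfSingularities.Theorems

/-- The prime of a generization only depends on the generization (transport along an equality of
points). [folklore] -/
theorem centreNew_primeOfSpecializes_congr {X : Scheme.{0}} {z η η' : X} (h : η ⤳ z) (h' : η' ⤳ z)
    (e : η = η') : primeOfSpecializes h = primeOfSpecializes h' := by
  subst e
  rfl

/-- Along `f`, the preimage of the prime of a generization `x' ⤳ z` of `X` is the prime of the
generization `f x' ⤳ f z` of `Y`. [folklore] -/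
theorem centreNew_comap_stalkMap_primeOfSpecializes {X Y : Scheme.{0}} (f : X ⟶ Y) {x' z : X}
    (h : x' ⤳ z) :
    (primeOfSpecializes h).comap (f.stalkMap z).hom = primeOfSpecializes (h.map f.continuous) := by
  change ((maximalIdeal _).comap (X.presheaf.stalkSpecializes h).hom).comap (f.stalkMap z).hom =
    (maximalIdeal _).comap (Y.presheaf.stalkSpecializes (h.map f.continuous)).hom
  rw [← IsLocalRing.maximalIdeal_comap (f.stalkMap x').hom, Ideal.comap_comap, Ideal.comap_comap,
    ← CommRingCat.hom_comp, ← CommRingCat.hom_comp, Scheme.Hom.stalkSpecializes_stalkMap]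

set_option maxHeartbeats 1600000 in
/-- **The formal model at a point of the orbit closure, with its completed centre** (de Jong 1996,
3.4 ¶2, along one orbit of a `G`-strict pair — de Jong 1997, proof of 5.11 ¶1). See the module
docstring for the content of the clauses: base-compatible model `e₁` with Cohen coordinates `ι` and
rebracketing `E`; `ν_{i₀} ≥ 2` and `f^#(wⱼ) ∈ 𝔭_{g₀ x} ↔ j = i₀`; the translates of `x` through `z`
are all `g₀ x`; the stalk at `z` of the reduced ideal of `cl(G · x)` is `𝔭_{g₀ x}`; and it completes
to `(u, v, T_{i₀})`. [cite: DeJong1996, 3.4, p. 63] [cite: DeJong1997, proof of Prop. 5.11, p. 618] -/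
theorem centreNew_exists_orbitModel (k : Type) [Field k] (Y : Scheme.{0}) [IsIntegral Y]
    (q : Y ⟶ Spec (.of k)) (hreg : Scheme.IsRegular Y) (D : Set Y)
    (hD : IsStrictNormalCrossingsDivisor Y D) (G : Type) [Group G] [Finite G] (ρY : G →* Aut Y)
    (hDG : (∀ g : G, (ρY g).hom.base '' D = D))
    (hDstrict : (∀ (g : G) (C : Set Y), Maximal (fun C : Set Y => IsIrreducible C ∧ C ⊆ D) C →
        (C ∩ (ρY g).hom.base '' C).Nonempty → (ρY g).hom.base '' C = C))
    (X : Scheme.{0}) [IsIntegral X] (f : X ⟶ Y) (ρX : G →* Aut X)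
    (hprojX : Motives.IsProjectiveOver (Over.mk (f ≫ q)))
    (hρf : ∀ g : G, (ρX g).hom ≫ f = f ≫ (ρY g).hom) (hss : IsSemiStableCurve f)
    (hqs : (∀ x : X, (¬ ∃ U : X.Opens, x ∈ U ∧ Smooth (U.ι ≫ f)) →
        ∃ e : AdicCompletion
            ((IsLocalRing.maximalIdeal (X.presheaf.stalk x)).map (Ideal.Quotient.mk
              ((IsLocalRing.maximalIdeal (Y.presheaf.stalk (f.base x))).map (f.stalkMap x).hom)))
            (X.presheaf.stalk x ⧸
              (IsLocalRing.maximalIdeal (Y.presheaf.stalk (f.base x))).map (f.stalkMap x).hom) ≃+*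
          MvPowerSeries (Fin 2) (Y.presheaf.stalk (f.base x) ⧸ IsLocalRing.maximalIdeal (Y.presheaf.stalk (f.base x))) ⧸
            Ideal.span {(MvPowerSeries.X 0 * MvPowerSeries.X 1 :
              MvPowerSeries (Fin 2) (Y.presheaf.stalk (f.base x) ⧸ IsLocalRing.maximalIdeal (Y.presheaf.stalk (f.base x))))},
          e.toRingHom.comp ((algebraMap (X.presheaf.stalk x ⧸
              (IsLocalRing.maximalIdeal (Y.presheaf.stalk (f.base x))).map (f.stalkMap x).hom) _).comp
            (Ideal.quotientMap ((IsLocalRing.maximalIdeal (Y.presheaf.stalk (f.base x))).map (f.stalkMap x).hom)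
              (f.stalkMap x).hom Ideal.le_comap_map)) =
          algebraMap (Y.presheaf.stalk (f.base x) ⧸ IsLocalRing.maximalIdeal (Y.presheaf.stalk (f.base x))) _))
    (hsm : Smooth (f ∣_ ⟨Dᶜ, hD.isClosed.isOpen_compl⟩))
    (x : X) (hx : x ∈ Scheme.singularLocusCodimLE X 2) {z : X} {g₀ : G}
    (hg₀ : (ρX g₀).hom.base x ⤳ z) :
    ∃ (m : ℕ) (w : Fin m → Y.presheaf.stalk (f.base z)) (ν : Fin m → ℕ) (i₀ : Fin m)
      (ι : Cpl (Y.presheaf.stalk (f.base z)) ≃+*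
        MvPowerSeries (Fin m) (ResidueField (Y.presheaf.stalk (f.base z))))
      (e₁ : Cpl (X.presheaf.stalk z) ≃+*
        NodeDeformationRing (Cpl (Y.presheaf.stalk (f.base z)))
          (∏ i, algebraMap _ (Cpl (Y.presheaf.stalk (f.base z))) (w i) ^ ν i))
      (E : NodeDeformationRing (Cpl (Y.presheaf.stalk (f.base z)))
          (∏ i, algebraMap _ (Cpl (Y.presheaf.stalk (f.base z))) (w i) ^ ν i) ≃+*
        FormalNodeRing (ResidueField (Y.presheaf.stalk (f.base z))) m ν),
      Ideal.span (Set.range w) = maximalIdeal (Y.presheaf.stalk (f.base z)) ∧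
      ringKrullDim (Y.presheaf.stalk (f.base z)) = m ∧
      (∀ i, ι (algebraMap _ _ (w i)) = MvPowerSeries.X i) ∧
      (∀ c, e₁ (completedStalkMap f z c) = NodeDeformationRing.ofBase _ _ c) ∧
      (∀ j : Fin 2, E (Ideal.Quotient.mk _ (MvPowerSeries.X j)) =
        Ideal.Quotient.mk _ (MvPowerSeries.X (Sum.inl j))) ∧
      (∀ c, E (NodeDeformationRing.ofBase _ _ c) =
        Ideal.Quotient.mk _ (MvPowerSeriesNested.inrHom (Fin 2) (Fin m) _ (ι c))) ∧
      2 ≤ ν i₀ ∧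
      (∀ j, (f.stalkMap z).hom (w j) ∈ primeOfSpecializes hg₀ ↔ j = i₀) ∧
      (∀ g : G, (ρX g).hom.base x ⤳ z → (ρX g).hom.base x = (ρX g₀).hom.base x) ∧
      stalkIdeal (vanishingIdeal ⟨closure (Set.range fun g : G => (ρX g).hom.base x),
        isClosed_closure⟩) z = primeOfSpecializes hg₀ ∧
      ((primeOfSpecializes hg₀).map (algebraMap _ (Cpl (X.presheaf.stalk z)))).map
        (e₁.trans E).toRingHom = triplePrime _ m ν i₀ := by
  classical
  haveI : IsNoetherian X := DeJong1996.isNoetherian_of_isProjectiveOver (f ≫ q) hprojX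
  haveI : IsLocallyNoetherian Y := isLocallyNoetherian_base hss
  haveI : Flat f := hss.flat
  haveI := hss.locallyOfFiniteType
  haveI : IsProper (f ≫ q) := Motives.IsProjectiveOver.isProper (X := Over.mk (f ≫ q)) hprojX
  -- notation
  set xg := (ρX g₀).hom.base x with hxgdef
  let A := Y.presheaf.stalk (f.base z)
  let B := X.presheaf.stalk z
  let φ : A →+* B := (f.stalkMap z).hom
  have hxg : xg ∈ Scheme.singularLocusCodimLE X 2 := mem_singularLocusCodimLE_of_iso (ρX g₀) hx
  -- `z` is a non-regular point, `f` is not smooth at `z`, and `f z ∈ D`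
  have hzreg : ¬ IsRegularLocalRing B :=
    closure_subset_not_isRegularLocalRing f q (S := {xg}) (fun y hy => by
      rw [Set.mem_singleton_iff] at hy; rw [hy]; exact hxg.1) (specializes_iff_mem_closure.mp hg₀)
  have hns : ¬ ∃ U : X.Opens, z ∈ U ∧ Smooth (U.ι ≫ f) := fun ⟨U, hzU, hU⟩ =>
    hzreg (isRegularLocalRing_of_smooth_of_isRegular hreg f hU hzU)
  have hzD : f.base z ∈ D := apply_mem_of_not_isRegularLocalRing_of_smooth hreg f hD.isClosed hsm hzreg
  -- a regular system of parameters at `f z` adapted to `D`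
  obtain ⟨r, e, t, s, -, hdim, hspan, hID⟩ := hD.exists_regularSystemOfParameters hzD
  set m := r + e with hm
  set w : Fin m → A := Fin.append t s with hw'
  have hw : Ideal.span (Set.range w) = maximalIdeal A := by rw [hw', range_fin_append, hspan]
  have hI : stalkIdeal (vanishingIdeal ⟨D, hD.isClosed⟩) (f.base z) =
      Ideal.span {∏ i ∈ Finset.univ.filter (fun i : Fin m => i.val < r), w i} := by
    obtain ⟨U, hU, hfzU, -⟩ :=
      exists_isAffineOpen_mem_and_subset (X := Y) (x := f.base z) (U := ⊤) (Opens.mem_top _)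
    have hcl : (⟨closure D, isClosed_closure⟩ : Closeds Y) = ⟨D, hD.isClosed⟩ :=
      Closeds.ext hD.isClosed.closure_eq
    rw [stalkIdeal_eq_map_germ _ ⟨U, hU⟩ hfzU, hw', Fin.prod_filter_lt_append, ← hcl]
    exact hID ⟨U, hU⟩ hfzU
  -- ### the base-compatible formal model at `z` and its formal node ring form
  obtain ⟨ν, ι, e₁, -, hι, he₁⟩ := centreNew_exists_baseModel k Y q hreg D hD X f hprojX hss hqs hsm
    z hns w hw hdim (Nat.le_add_right r e) hI
  have hρ : ∀ a : A, e₁ (algebraMap B (Cpl B) (φ a)) =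
      NodeDeformationRing.ofBase _ _ (algebraMap A (Cpl A) a) := by
    intro a
    have h1 : algebraMap B (Cpl B) (φ a) = completedStalkMap f z (algebraMap A (Cpl A) a) := by
      rw [AdicCompletion.algebraMap_apply, Algebra.algebraMap_self_apply,
        AdicCompletion.algebraMap_apply, Algebra.algebraMap_self_apply, completedStalkMap_of]
    rw [h1]
    exact he₁ _
  obtain ⟨E, het, hEX, hEC⟩ := centreNew_formalNodeRing_of_baseModel w ν ι hι e₁ φ hρ
  set eM := e₁.trans E with heM
  -- ### `𝒪_{X,z}` is a G-ring; 3.4 ¶2 for each translate through `z`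
  have hG : IsGRing B := isGRing_stalk_of_polynomial Matsumura1987_32_polynomial_holds (f ≫ q) z
  haveI : Module.FaithfullyFlat B (Cpl B) := Module.FaithfullyFlat.of_flat_of_isLocalHom
  have key : ∀ (g : G) (hg : (ρX g).hom.base x ⤳ z), ∃ i : Fin m, 2 ≤ ν i ∧
      (∀ j, φ (w j) ∈ primeOfSpecializes hg ↔ j = i) ∧
      ((primeOfSpecializes hg).map (algebraMap B (Cpl B))).map eM.toRingHom = triplePrime _ m ν i := by
    intro g hg
    set P : Ideal B := primeOfSpecializes hg with hPdef
    letI algP : Algebra B (X.presheaf.stalk ((ρX g).hom.base x)) :=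
      (X.presheaf.stalkSpecializes hg).hom.toAlgebra
    haveI : IsLocalization.AtPrime (X.presheaf.stalk ((ρX g).hom.base x)) P :=
      isLocalizationAtPrime_stalkSpecializes hg
    let eP : Localization.AtPrime P ≃ₐ[B] X.presheaf.stalk ((ρX g).hom.base x) :=
      IsLocalization.algEquiv P.primeCompl (Localization.AtPrime P) (X.presheaf.stalk ((ρX g).hom.base x))
    have hxg' : (ρX g).hom.base x ∈ Scheme.singularLocusCodimLE X 2 :=
      mem_singularLocusCodimLE_of_iso (ρX g) hx
    have hPreg : ¬ IsRegularLocalRing (Localization.AtPrime P) := fun h =>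
      hxg'.1 (IsRegularLocalRing.of_ringEquiv eP.toRingEquiv)
    have hPdim : ringKrullDim (Localization.AtPrime P) ≤ 2 := by
      rw [ringKrullDim_eq_of_ringEquiv eP.toRingEquiv]
      exact hxg'.2
    obtain ⟨i, hi, hti, hJ⟩ :=
      codimTwo_map_adicCompletion_eq_triplePrime hG eM (fun i => φ (w i)) het P hPreg hPdim
    refine ⟨i, hi, fun j => ⟨fun hmem => ?_, ?_⟩, hJ⟩
    · have h1 : eM (algebraMap B (Cpl B) (φ (w j))) ∈
          ((P.map (algebraMap B (Cpl B))).map eM.toRingHom) :=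
        Ideal.mem_map_of_mem _ (Ideal.mem_map_of_mem _ hmem)
      rw [het j, hJ] at h1
      have h3 : (MvPowerSeries.X (Sum.inr j) : MvPowerSeries (Fin 2 ⊕ Fin m) (ResidueField A)) ∈
          (triplePrime _ m ν i).comap (Ideal.Quotient.mk _) := h1
      rw [comap_triplePrime _ (show ν i ≠ 0 by omega)] at h3
      by_contra hne
      exact X_inr_notMem_span_tripleVars _ hne h3
    · rintro rfl
      exact hti
  obtain ⟨i₀, hi₀, hmem₀, hJ₀⟩ := key g₀ hg₀
  -- ### the translates through `z` coincide
  have hxD : f.base x ∈ D := apply_mem_of_not_isRegularLocalRing_of_smooth hreg f hD.isClosed hsm hx.1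
  have hdimx : ringKrullDim (Y.presheaf.stalk (f.base x)) ≤ 1 :=
    ringKrullDim_base_le_one_of_codimLE f (hss.isReduced_fiber _) (hreg _) hx
  have huniq : ∀ g : G, (ρX g).hom.base x ⤳ z → (ρX g).hom.base x = xg := by
    intro g hg
    obtain ⟨i, -, hmem, hJ⟩ := key g hg
    -- same point of `Y` underneath, hence same index
    have hfeq := centreNew_apply_eq_of_specializes hreg hD ρY hDG hDstrict f ρX hρf hxD hdimx hg hg₀
    have hq : ∀ j, φ (w j) ∈ primeOfSpecializes hg ↔ φ (w j) ∈ primeOfSpecializes hg₀ := by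
      intro j
      rw [← Ideal.mem_comap, ← Ideal.mem_comap, centreNew_comap_stalkMap_primeOfSpecializes,
        centreNew_comap_stalkMap_primeOfSpecializes,
        centreNew_primeOfSpecializes_congr (hg.map f.continuous) (hg₀.map f.continuous) hfeq]
    have hii : i = i₀ := by
      have h1 := (hmem i).mpr rfl
      rw [hq] at h1
      exact (hmem₀ i).mp h1
    subst hii
    -- same completed prime, same prime, same point
    have hPP : primeOfSpecializes hg = primeOfSpecializes hg₀ := by
      have h1 : (primeOfSpecializes hg).map (algebraMap B (Cpl B)) =
          (primeOfSpecializes hg₀).map (algebraMap B (Cpl B)) := by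
        have h2 := hJ.trans hJ₀.symm
        have h3 := congrArg (Ideal.comap eM.toRingHom) h2
        rwa [Ideal.comap_map_of_bijective eM.toRingHom eM.bijective,
          Ideal.comap_map_of_bijective eM.toRingHom eM.bijective] at h3
      rw [← (primeOfSpecializes hg).comap_map_eq_self_of_faithfullyFlat (B := Cpl B),
        ← (primeOfSpecializes hg₀).comap_map_eq_self_of_faithfullyFlat (B := Cpl B), h1]
    exact Motives.eq_of_comap_maximalIdeal_eq hg hg₀ hPP
  -- ### the stalk of the ideal of `Z` at `z` is `𝔭_{g₀ x}`
  have hJ : stalkIdeal (vanishingIdeal ⟨closure (Set.range fun g : G => (ρX g).hom.base x),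
      isClosed_closure⟩) z = primeOfSpecializes hg₀ := by
    rw [stalkIdeal_vanishingIdeal_eq_vanishingIdeal_setOf]
    have hset : {p : PrimeSpectrum (X.presheaf.stalk z) |
        X.fromSpecStalk z p ∈ ((⟨closure (Set.range fun g : G => (ρX g).hom.base x),
          isClosed_closure⟩ : Closeds X) : Set X)} =
        PrimeSpectrum.zeroLocus (primeOfSpecializes hg₀) := by
      ext p
      have hpz := fromSpecStalk_specializes p
      constructor
      · intro hp
        obtain ⟨g, hg⟩ := (centreNew_mem_closure_orbit_iff ρX x _).mp hp
        have hgz : (ρX g).hom.base x ⤳ z := hg.trans hpz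
        rw [huniq g hgz] at hg
        have h1 := primeOfSpecializes_le_of_specializes hpz hg₀ hg
        rw [primeOfSpecializes_fromSpecStalk] at h1
        exact h1
      · intro hp
        have h1 : primeOfSpecializes hg₀ ≤ primeOfSpecializes hpz := by
          rw [primeOfSpecializes_fromSpecStalk]; exact hp
        have h2 := specializes_of_primeOfSpecializes_le hpz hg₀ h1
        exact (centreNew_mem_closure_orbit_iff ρX x _).mpr ⟨g₀, h2⟩
    rw [hset, PrimeSpectrum.vanishingIdeal_zeroLocus_eq_radical]
    exact (Ideal.IsPrime.radical inferInstance)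
  exact ⟨m, w, ν, i₀, ι, e₁, E, hw, hdim, hι, he₁, hEX, hEC, hi₀, hmem₀, huniq, hJ, hJ₀⟩

end Summit.ResolutionOfSingularities.ResolutionOfSingularities.Theorems

end
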